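import Summits.FinalStateConjecture.FinalStateConjecture.Theorems.SwallowTheDatumKerrShieldedSettlesStubCollarCauchy
import Literature.Geometry.Lorentzian.KerrHorizonCausality
import Literature.Geometry.Lorentzian.KerrHyperboloidalFlux
import Literature.Geometry.Lorentzian.KerrTimelikeSpan
import Literature.Geometry.Lorentzian.KerrFarEnergyComparison
import HarnessLib

/-!
# Crux `EIHFluxBalance.ModulatedKerrHandoff` (stmt-FinalStateConjecture-10167), line `swallow-transfer`,
# stub `stub_exteriorLastExit` — support part 2: no future timelike escape through the event horizon

Pointwise horizon algebra of the ingoing Kerr–Schild chart (`g = η + 2H ℓ ⊗ ℓ`, `Literature/…/KerrSchild.lean`)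
at a point with Kerr–Schild radius `r = r₊` (`Δ(r₊) = 0`, `r₊² + a² = 2 M r₊`, `|a| < M`):

* `radiusGrad_nonpos_of_causal_of_radius_eq_rPlus` — a future causal vector `v` has `dr(v) ≤ 0`: at `r = r₊` every
  clock `dt* − c dr`, `c ≥ 0`, runs forward (`CollarCauchy.clock_pos`: `−Σ + c²(r² + a²) − 2Mr(1 + c)² = −Σ − 2Mr(1 + 2c)
  < 0`), so `c · dr(v) < v⁰` for every `c ≥ 0`;
* `bilin_nonneg_of_radiusGrad_eq_zero_of_radius_eq_rPlus` — a vector TANGENT to the horizon (`dr(v) = 0`) is not timelike: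
  with `ℓ⃗·ℓ⃗ = 1`, `ℓ⃗·∇r = 1`, `|∇r|² Σ = r² + a² = 2Mr = 2H Σ` one has `2H = |∇r|² =: G ≥ 1` and, by Cauchy–Schwarz for
  `ℓ⃗ − ∇r/G ⊥`-decomposition, `G (ℓ⃗·v⃗)² ≤ (G − 1)|v⃗|²` whenever `∇r·v⃗ = 0`, whence
  `g(v, v) = (G − 1)(v⁰)² + 2G v⁰ (ℓ⃗·v⃗) + G(ℓ⃗·v⃗)² + |v⃗|² ≥ 0` (the horizon is a null hypersurface);
* `radiusGrad_neg_of_timelike_of_radius_eq_rPlus` — hence a future TIMELIKE vector at `r = r₊` has `dr(v) < 0`;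
* `rPlus_lt_radius_of_le'` / `rPlus_lt_radius_of_le` — **exterior persistence along future timelike chart curves**: if `r > r₊` at a parameter
  `t₁` then `r > r₊` at every earlier parameter of the (order-connected) parameter set (a last parameter with
  `r ≤ r₊` before `t₁` would be a horizon point left with `ṙ < 0`, contradiction).

Everything is proved; no definitions, no named facts.  Hawking–Ellis 1973, §5.6 and Prop. 9.2.1 (nothing escapes the
black hole); Dafermos–Rodnianski–Shlapentokh-Rothman arXiv:1402.7034, §2.2.5.
-/

set_option linter.dupNamespace false

noncomputable section

open Set Filter
open scoped Manifold ContDiff Topology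
open Literature.Geometry.Lorentzian
open Summit.FinalStateConjecture.FinalStateConjecture.Theorems.KerrShieldedDataExist.Negative
open Summit.FinalStateConjecture.FinalStateConjecture.Theorems.SwallowTheDatum.KerrShieldedSettles.CollarCauchy

namespace Summit.FinalStateConjecture.FinalStateConjecture.Theorems.EIHFluxBalance.ExteriorLastExit

/-! ## Pointwise horizon algebra at `r = r₊` -/

section Pointwise

variable [Kerr.Facts] {M a : ℝ}

/-- **At `r = r₊` every future causal vector has `dr(v) ≤ 0`.**  For `c ≥ 0` the clock `dt* − c dr` is timelike and
co-oriented there (`r₊² + a² = 2Mr₊` makes the numerator `−Σ − 2Mr(1 + 2c) < 0`), so `clock_pos` gives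
`c · dr(v) < v⁰` for every `c ≥ 0`; if `dr(v) > 0` the choice `c = 2v⁰/dr(v)` is absurd.
DRSR arXiv:1402.7034, §2.2.5; Hawking–Ellis 1973, §5.6. [cite: DafermosRodnianskiShlapentokhrothman2014, §2.2.5] -/
theorem radiusGrad_nonpos_of_causal_of_radius_eq_rPlus (hM : 0 ≤ M) (ha : |a| < M) {x : E4}
    (hx : Kerr.radius a x = Kerr.rPlus M a) {v : E4} (hvv : Kerr.bilin M a x v v ≤ 0) (hv0 : v ≠ 0)
    (hVv : Kerr.bilin M a x (Kerr.timeVector M a x) v < 0) :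
    Kerr.radiusGrad a (E4.spatial x) (E4.spatial v) ≤ 0 := by
  have hM0 : 0 < M := mass_pos ha
  have hrp : 0 < Kerr.rPlus M a := by
    unfold Kerr.rPlus; linarith [Real.sqrt_nonneg (M ^ 2 - a ^ 2)]
  have hr : 0 < Kerr.radius a x := by rw [hx]; exact hrp
  have hS : 0 < Kerr.blSigma a (E4.spatial x) := Kerr.blSigma_spatial_pos hr
  have hhor : Kerr.radius a x ^ 2 + a ^ 2 = 2 * M * Kerr.radius a x := by
    rw [hx]; exact Kerr.rPlus_sq_add_sq ha.le
  have hclock : ∀ c : ℝ, 0 ≤ c → c * Kerr.radiusGrad a (E4.spatial x) (E4.spatial v) < v 0 := by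
    intro c hc
    have hnum : -Kerr.blSigma a (E4.spatial x) + c ^ 2 * (Kerr.radius a x ^ 2 + a ^ 2) -
        2 * M * Kerr.radius a x * (1 + c) ^ 2 < 0 := by
      rw [hhor]
      nlinarith [mul_nonneg (mul_nonneg (mul_nonneg zero_le_two hM) hr.le) hc]
    have hco : 0 < 1 + 2 * Kerr.scalarH M a x * (1 + c) := by
      have hH := Kerr.scalarH_nonneg hM a x
      positivity
    have h := clock_pos hM hr hnum hco hvv hv0 hVv
    linarith
  by_contra hpos
  push Not at hpos
  have hv00 : 0 < v 0 := by simpa using hclock 0 le_rfl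
  have h := hclock (2 * v 0 / Kerr.radiusGrad a (E4.spatial x) (E4.spatial v)) (by positivity)
  rw [div_mul_cancel₀ _ hpos.ne'] at h
  linarith

omit [Kerr.Facts] in
/-- **A vector tangent to the event horizon is not timelike** (the horizon `{r = r₊}` is a null hypersurface of the
Kerr–Schild chart): at a point with `r = r₊`, `dr(v) = 0` implies `g(v, v) ≥ 0`.  In components
(`ℓ₀ = 1`, `∑ ℓᵢ² = 1`: `Kerr.sum_sq_nullCovectorFun`; `∑ ℓᵢ ∂ᵢr = 1`: `Kerr.sum_nullCovectorFun_mul_radiusGradVec`;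
`(∑ (∂ᵢr)²) Σ = r² + a²`: `Kerr.sum_sq_radiusGradVec_mul_blSigma`; `2H Σ = 2Mr = r² + a²` at `r₊`): `2H = G := |∇r|² ≥ 1`
(`Σ ≤ r² + a²`), Cauchy–Schwarz for `Gℓ⃗ − ∇r` gives `G β² ≤ (G − 1)|v⃗|²`, `β = ℓ⃗·v⃗`, and then
`(G − 1) g(v,v) = ((G − 1)v⁰ + Gβ)² + ((G − 1)|v⃗|² − Gβ²) ≥ 0`.  Hawking–Ellis 1973, §5.6 and Prop. 9.2.1.
[cite: HawkingEllis1973CUP, §5.6] -/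
theorem bilin_nonneg_of_radiusGrad_eq_zero_of_radius_eq_rPlus (ha : |a| < M) {x : E4}
    (hx : Kerr.radius a x = Kerr.rPlus M a) {v : E4}
    (hdr : Kerr.radiusGrad a (E4.spatial x) (E4.spatial v) = 0) :
    0 ≤ Kerr.bilin M a x v v := by
  have hM0 : 0 < M := mass_pos ha
  have hrp : 0 < Kerr.rPlus M a := by
    unfold Kerr.rPlus; linarith [Real.sqrt_nonneg (M ^ 2 - a ^ 2)]
  have hr : 0 < Kerr.radius a x := by rw [hx]; exact hrp
  have hS : 0 < Kerr.blSigma a (E4.spatial x) := Kerr.blSigma_spatial_pos hr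
  have hhor : Kerr.radius a x ^ 2 + a ^ 2 = 2 * M * Kerr.radius a x := by
    rw [hx]; exact Kerr.rPlus_sq_add_sq ha.le
  -- the component identities at `x`
  have hll := Kerr.sum_sq_nullCovectorFun hr
  have hlg := Kerr.sum_nullCovectorFun_mul_radiusGradVec hr
  have hgg := Kerr.sum_sq_radiusGradVec_mul_blSigma hr
  have hH : Kerr.scalarH M a x * Kerr.blSigma a (E4.spatial x) = M * Kerr.radius a x := by
    rw [Kerr.scalarH_eq_div_blSigma M a hr]
    field_simp
  have hSle : Kerr.blSigma a (E4.spatial x) ≤ Kerr.radius a x ^ 2 + a ^ 2 := by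
    rw [Kerr.blSigma_spatial_eq]
    nlinarith [Kerr.radius_le_spatialNorm a x, Kerr.radius_nonneg a x]
  -- `dr(v)` and `ℓ(v)`, `η(v, v)` in components
  have hdr' : Kerr.radiusGradVec a (E4.spatial x) 0 * v 1 + Kerr.radiusGradVec a (E4.spatial x) 1 * v 2 +
      Kerr.radiusGradVec a (E4.spatial x) 2 * v 3 = 0 := by
    rw [Kerr.radiusGrad_apply] at hdr
    simp only [PiLp.inner_apply, RCLike.inner_apply, conj_trivial, Fin.sum_univ_three, E4.spatial_apply,
      Fin.succ_zero_eq_one, Fin.succ_one_eq_two, Fin.isValue] at hdr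
    have h3 : (Fin.succ 2 : Fin 4) = 3 := rfl
    rw [h3] at hdr
    linear_combination hdr
  have h0 : Kerr.nullCovectorFun a x 0 = 1 := by simp [Kerr.nullCovectorFun]
  have hlv : Kerr.nullCovector a x v = v 0 + (Kerr.nullCovectorFun a x 1 * v 1 +
      Kerr.nullCovectorFun a x 2 * v 2 + Kerr.nullCovectorFun a x 3 * v 3) := by
    rw [Kerr.nullCovector, E4.covector_apply, Fin.sum_univ_four, h0]
    ring
  have hη : Minkowski.bilin v v = -(v 0) ^ 2 + (v 1 ^ 2 + v 2 ^ 2 + v 3 ^ 2) := by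
    simp [Minkowski.bilin_apply, Fin.sum_univ_three]
    ring
  rw [Kerr.bilin_apply, hη, hlv]
  -- name the atoms
  set g0 := Kerr.radiusGradVec a (E4.spatial x) 0 with hg0
  set g1 := Kerr.radiusGradVec a (E4.spatial x) 1 with hg1
  set g2 := Kerr.radiusGradVec a (E4.spatial x) 2 with hg2
  set l1 := Kerr.nullCovectorFun a x 1 with hl1
  set l2 := Kerr.nullCovectorFun a x 2 with hl2
  set l3 := Kerr.nullCovectorFun a x 3 with hl3
  set Hs := Kerr.scalarH M a x with hHs
  set S := Kerr.blSigma a (E4.spatial x) with hSS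
  set r := Kerr.radius a x with hrr
  set v0 := v 0
  set w1 := v 1
  set w2 := v 2
  set w3 := v 3
  -- `G := ∑ (∂ᵢr)²`, `2H = G`, `G ≥ 1`
  set G := g0 ^ 2 + g1 ^ 2 + g2 ^ 2 with hG
  have hGS : G * S = r ^ 2 + a ^ 2 := hgg
  have h2H : 2 * Hs = G := by
    have h1 : (2 * Hs) * S = G * S := by rw [hGS, hhor]; linarith [hH]
    exact mul_right_cancel₀ hS.ne' h1
  have hG1 : 1 ≤ G := by
    by_contra hlt
    push Not at hlt
    have : G * S < 1 * S := mul_lt_mul_of_pos_right hlt hS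
    linarith
  -- Cauchy–Schwarz for `G ℓ⃗ − ∇r` against `v⃗`, using `∇r · v⃗ = 0`
  set β := l1 * w1 + l2 * w2 + l3 * w3 with hβ
  set W := w1 ^ 2 + w2 ^ 2 + w3 ^ 2 with hW
  have hCS := Kerr.sq_dot_le_three (G * l1 - g0) (G * l2 - g1) (G * l3 - g2) w1 w2 w3
  have hsum : (G * l1 - g0) * w1 + (G * l2 - g1) * w2 + (G * l3 - g2) * w3 = G * β := by
    rw [hβ]; linear_combination (-1 : ℝ) * hdr'
  have hnorm : (G * l1 - g0) ^ 2 + (G * l2 - g1) ^ 2 + (G * l3 - g2) ^ 2 = G ^ 2 - G := by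
    have e1 : (G * l1 - g0) ^ 2 + (G * l2 - g1) ^ 2 + (G * l3 - g2) ^ 2 =
        G ^ 2 * (l1 ^ 2 + l2 ^ 2 + l3 ^ 2) - 2 * G * (l1 * g0 + l2 * g1 + l3 * g2) +
          (g0 ^ 2 + g1 ^ 2 + g2 ^ 2) := by ring
    rw [e1, hll, hlg, ← hG]; ring
  rw [hsum, hnorm] at hCS
  have hkey : G * β ^ 2 ≤ (G - 1) * W := by
    have hGpos : 0 < G := by linarith
    have e1 : (G * β) ^ 2 = G * (G * β ^ 2) := by ring
    have e2 : (G ^ 2 - G) * W = G * ((G - 1) * W) := by ring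
    rw [e1, e2] at hCS
    exact le_of_mul_le_mul_left hCS hGpos
  -- conclude
  have hW0 : 0 ≤ W := by positivity
  rw [h2H]
  rcases hG1.lt_or_eq with hGlt | hGeq
  · have hG1' : 0 < G - 1 := by linarith
    have hident : (G - 1) * (-v0 ^ 2 + W + G * ((v0 + β) * (v0 + β))) =
        ((G - 1) * v0 + G * β) ^ 2 + ((G - 1) * W - G * β ^ 2) := by ring
    have hnn : 0 ≤ (G - 1) * (-v0 ^ 2 + W + G * ((v0 + β) * (v0 + β))) := by
      rw [hident]
      have hsq := sq_nonneg ((G - 1) * v0 + G * β)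
      linarith
    exact nonneg_of_mul_nonneg_right hnn hG1'
  · have hβ0 : β = 0 := by
      have h1 : G * β ^ 2 ≤ 0 := by
        have : (G - 1) * W = 0 := by rw [← hGeq]; ring
        rw [this] at hkey; exact hkey
      rw [← hGeq, one_mul] at h1
      exact pow_eq_zero_iff two_ne_zero |>.1 (le_antisymm h1 (sq_nonneg β))
    rw [← hGeq, hβ0]
    have e : -v0 ^ 2 + W + 1 * ((v0 + 0) * (v0 + 0)) = W := by ring
    rw [e]
    exact hW0

/-- **At `r = r₊` every future timelike vector enters the black hole: `dr(v) < 0`.**  (`dr(v) ≤ 0` by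
`radiusGrad_nonpos_of_causal_of_radius_eq_rPlus`; equality would make `v` tangent to the null hypersurface
`{r = r₊}`, contradicting `g(v, v) < 0` by `bilin_nonneg_of_radiusGrad_eq_zero_of_radius_eq_rPlus`.)
Hawking–Ellis 1973, Prop. 9.2.1. [cite: HawkingEllis1973CUP, Prop. 9.2.1] -/
theorem radiusGrad_neg_of_timelike_of_radius_eq_rPlus (hM : 0 ≤ M) (ha : |a| < M) {x : E4}
    (hx : Kerr.radius a x = Kerr.rPlus M a) {v : E4} (hvv : Kerr.bilin M a x v v < 0)
    (hVv : Kerr.bilin M a x (Kerr.timeVector M a x) v < 0) :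
    Kerr.radiusGrad a (E4.spatial x) (E4.spatial v) < 0 := by
  have hv0 : v ≠ 0 := fun h ↦ by rw [h] at hvv; simp at hvv
  rcases (radiusGrad_nonpos_of_causal_of_radius_eq_rPlus hM ha hx hvv.le hv0 hVv).lt_or_eq with h | h
  · exact h
  · exact absurd (bilin_nonneg_of_radiusGrad_eq_zero_of_radius_eq_rPlus ha hx h) (not_le.2 hvv)

end Pointwise

/-! ## Exterior persistence along future timelike curves of the chart -/

section Curve

/-- A real function with a negative derivative at `t` is below its value at `t` just to the right of `t`. [folklore] -/
theorem eventually_lt_of_hasDerivAt_neg {f : ℝ → ℝ} {f' t : ℝ} (hf : HasDerivAt f f' t) (hf' : f' < 0) :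
    ∀ᶠ u in 𝓝[>] t, f u < f t := by
  have ht : Tendsto (slope f t) (𝓝[>] t) (𝓝 f') :=
    (hasDerivWithinAt_iff_tendsto_slope' (lt_irrefl t)).1 (hf.hasDerivWithinAt (s := Ioi t))
  filter_upwards [ht.eventually (gt_mem_nhds hf'), self_mem_nhdsWithin] with u hu hut
  rw [slope_def_field] at hu
  have hsub : 0 < u - t := sub_pos.2 hut
  have key : f u - f t < 0 := by
    rcases div_neg_iff.1 hu with h | h
    · exact absurd h.2 (not_lt.2 hsub.le)
    · exact h.1
  linarith

/-- **Exterior persistence: a future timelike chart curve which is in `{r > r₊}` at a parameter `t₁` was in `{r > r₊}` at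
every earlier parameter** of its order-connected parameter set.  Otherwise let `t₂ < t₁` be the last earlier parameter
with `r ≤ r₊`; continuity forces `r(γ t₂) = r₊`, and `radiusGrad_neg_of_timelike_of_radius_eq_rPlus` makes `r ∘ γ`
strictly below `r₊` just after `t₂`, contradicting the choice of `t₂`.  Hawking–Ellis 1973, Prop. 9.2.1 (nothing leaves
the black hole region). [cite: HawkingEllis1973CUP, Prop. 9.2.1] -/
theorem rPlus_lt_radius_of_le' [Kerr.Facts] {M a r₁ : ℝ} {hM : 0 ≤ M} {γ : ℝ → Kerr.region a r₁} {s : Set ℝ}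
    (ha : |a| < M) (hs : s.OrdConnected)
    (hγ : (Kerr.smoothMetric M a r₁).IsFutureTimelikeCurveOn ((Kerr.timeOrientation M a r₁ hM).ofLE le_top) γ s)
    {t₀ t₁ : ℝ} (ht₀ : t₀ ∈ s) (ht₁ : t₁ ∈ s) (h01 : t₀ ≤ t₁)
    (hr₁ : Kerr.rPlus M a < Kerr.radius a (γ t₁ : E4)) : Kerr.rPlus M a < Kerr.radius a (γ t₀ : E4) := by
  by_contra hle
  push Not at hle
  set ρ : ℝ → ℝ := fun σ ↦ Kerr.radius a (γ σ : E4) with hρ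
  have hI : Icc t₀ t₁ ⊆ s := hs.out ht₀ ht₁
  have hder : ∀ σ ∈ s, HasDerivAt ρ
      (Kerr.radiusGrad a (E4.spatial (γ σ : E4)) (E4.spatial (deriv (fun σ => (γ σ : E4)) σ))) σ :=
    fun σ hσ ↦ hasDerivAt_radius_comp hγ hσ
  have hcont : ContinuousOn ρ (Icc t₀ t₁) := fun σ hσ ↦ (hder σ (hI hσ)).continuousAt.continuousWithinAt
  -- the last parameter in `[t₀, t₁]` with `r ≤ r₊`
  set A : Set ℝ := Icc t₀ t₁ ∩ ρ ⁻¹' Iic (Kerr.rPlus M a) with hA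
  have hAne : A.Nonempty := ⟨t₀, left_mem_Icc.2 h01, hle⟩
  have hAbdd : BddAbove A := ⟨t₁, fun σ hσ ↦ hσ.1.2⟩
  have hAclosed : IsClosed A := hcont.preimage_isClosed_of_isClosed isClosed_Icc isClosed_Iic
  set t₂ := sSup A with ht₂
  have ht₂A : t₂ ∈ A := hAclosed.csSup_mem hAne hAbdd
  have ht₂I : t₂ ∈ Icc t₀ t₁ := ht₂A.1
  have ht₂le : ρ t₂ ≤ Kerr.rPlus M a := ht₂A.2
  have ht₂lt : t₂ < t₁ := by
    rcases ht₂I.2.lt_or_eq with h | h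
    · exact h
    · exact absurd (h ▸ ht₂le) (not_le.2 hr₁)
  have habove : ∀ σ ∈ Ioc t₂ t₁, Kerr.rPlus M a < ρ σ := by
    intro σ hσ
    by_contra hσle
    push Not at hσle
    have hσA : σ ∈ A := ⟨⟨ht₂I.1.trans hσ.1.le, hσ.2⟩, hσle⟩
    exact absurd (le_csSup hAbdd hσA) (not_le.2 hσ.1)
  -- `r(γ t₂) = r₊` by continuity from the right
  have ht₂s : t₂ ∈ s := hI ht₂I
  have heq : ρ t₂ = Kerr.rPlus M a := by
    refine le_antisymm ht₂le ?_
    have hmem : t₂ ∈ closure (Ioc t₂ t₁) := by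
      rw [closure_Ioc ht₂lt.ne]; exact left_mem_Icc.2 ht₂lt.le
    haveI : (𝓝[Ioc t₂ t₁] t₂).NeBot := mem_closure_iff_nhdsWithin_neBot.1 hmem
    have hcw : Tendsto ρ (𝓝[Ioc t₂ t₁] t₂) (𝓝 (ρ t₂)) :=
      ((hder t₂ ht₂s).continuousAt.continuousWithinAt).tendsto
    exact ge_of_tendsto hcw (eventually_nhdsWithin_of_forall fun σ hσ ↦ (habove σ hσ).le)
  -- at the horizon point the curve enters the hole: `ρ` decreases strictly just after `t₂`
  obtain ⟨hd, htl, hfd⟩ := curve_velocity hγ ht₂s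
  have hneg := radiusGrad_neg_of_timelike_of_radius_eq_rPlus hM ha heq htl hfd
  have hev := eventually_lt_of_hasDerivAt_neg (hder t₂ ht₂s) hneg
  obtain ⟨u, hu, huI⟩ := (hev.and (Ioc_mem_nhdsGT ht₂lt)).exists
  have h1 := habove u huI
  rw [heq] at hu
  exact absurd hu (not_lt.2 h1.le)

/-- **Exterior persistence** (registered form of `rPlus_lt_radius_of_le'`, stub `rPlus_lt_radius_of_le` of crux
stmt-FinalStateConjecture-10167): a future timelike Kerr chart curve in `{r > r₊}` at `t₁` was in `{r > r₊}` at every earlier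
parameter.  Hawking–Ellis 1973, Prop. 9.2.1. [cite: HawkingEllis1973CUP, Prop. 9.2.1] -/
theorem rPlus_lt_radius_of_le : open Literature.Geometry.Lorentzian in ∀ [Kerr.Facts] {M a r₁ : ℝ} {hM : 0 ≤ M} {γ : ℝ → Kerr.region a r₁} {s : Set ℝ}, |a| < M → s.OrdConnected → (Kerr.smoothMetric M a r₁).IsFutureTimelikeCurveOn ((Kerr.timeOrientation M a r₁ hM).ofLE le_top) γ s → ∀ {t₀ t₁ : ℝ}, t₀ ∈ s → t₁ ∈ s → t₀ ≤ t₁ → Kerr.rPlus M a < Kerr.radius a (γ t₁ : E4) → Kerr.rPlus M a < Kerr.radius a (γ t₀ : E4) :=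
  fun ha hs hγ _ _ ht₀ ht₁ h01 hr₁ ↦ rPlus_lt_radius_of_le' ha hs hγ ht₀ ht₁ h01 hr₁

end Curve

end Summit.FinalStateConjecture.FinalStateConjecture.Theorems.EIHFluxBalance.ExteriorLastExit

end
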